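import Summits.ResolutionOfSingularities.ResolutionOfSingularities.Theorems.PurelyInseparableDim4ResConePowerChainTilt
import Summits.ResolutionOfSingularities.ResolutionOfSingularities.Theorems.PurelyInseparableDim4ResConeExceptionalRestriction
import Summits.ResolutionOfSingularities.ResolutionOfSingularities.Theorems.PurelyInseparableDim4IsolatedHasseLedger
import Summits.ResolutionOfSingularities.ResolutionOfSingularities.Theorems.PurelyInseparableDim4IsolatedHasseContact
import Summits.ResolutionOfSingularities.ResolutionOfSingularities.Theorems.PurelyInseparableDim4ResConeLedgerLinear
import Summits.ResolutionOfSingularities.ResolutionOfSingularities.Theorems.PurelyInseparableDim4ResConePowerConeWitness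
import HarnessLib
import HarnessLib.Audit.Tags

/-!
# Purely inseparable four-folds — SLICE B along a chain, (K11) part 1: the LEDGER SEED at every birth and the
# DOUBLE-LEDGER KILL «no heavy pair» at any stage of a constant-`(d, e_G = 3)` stretch, from two one-letter ledgers

[OURS · counted 0 · cell `res-dim4-pi` · K2(p) lane, SLICE-B architecture of record ARCH v1.1 (holder res-dim4-p-12 g3,
brick (K11) «chain-level (DL) assembly» named for res-dim4-p-2 g3 on the bus 2026-08-28T23:30:27Z) · K lane crit-4 g2.]
Nothing here proves K2(p) = `RidgeBudget.NoAboveFloorTrap p p`, `NoIsolatedTrap p p` or resolution of singularities in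
dimension ≥ 4 / characteristic `p`.  AI kernel work, weaker than expert review.

Along a constant-`(d, e_G = 3)` stretch (`1 ≤ d < p`) of an isolated above-floor `Step0 p` chain with `x^{r₀} ∣ F₀` the frame
is ONE per stretch (`ResCone.chain_powerCone_package`, p674751): `resForm (c k) = a_k · ℓ_k^d`, `ℓ_k(j_k) + ℓ_k·b_k = 0`.
Writing `G_k := F_k / x^{r_k}` (`(c k).F.divMonomial (c k).r`), idea-4's I-4-7 (LEDGER)/(DL) becomes, in the holder's
polynomial dress (memo §1, K1–K10):

* §1 frame helpers: `resForm_eq_homogeneousComponent_divMonomial` (the cone IS the degree-`d` part of `G`),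
  `ordZero_divMonomial_eq`, `coeff_eq_zero_of_mem_span_X`, `homogeneousComponent_not_mem_span_X_of_powerCone`
  (a power cone alive at a letter `c ≠ a` is not in `(x_a)`), `coeff_single_ne_zero_of_ledger` (K9 read at a letter
  `e ≠ a` carrying `ℓ`: the ledger polynomial has `coeff_{x_e} h ≠ 0`);
* §2 **`stretch_seed_ledger`** — THE SEED (K11a base case): at every stage `k ≥ k₀` the letter `j_k` is BORN with
  multiplicity `o_k − p ≥ 1` and the ledger `G_{k+1} ∈ (x_{j_k}, L̃_k^d)` (res-dim4-p-3 g3's K3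
  `divMonomial_step_mem_span_of_powerCone`), `L̃_k ∈ 𝔪₀` alive off `j_k`;
* §3 **`stretch_false_of_two_ledgers`** — THE KILL FROM TWO ONE-LETTER LEDGERS (K11b core): at a stage `k ≥ k₀`, two
  distinct letters `a, b′` with ledgers `u_a G_k ∈ (x_a, h_a^d)`, `u_b G_k ∈ (x_{b′}, h_b^d)` (units, `h_a, h_b ∈ 𝔪₀`), a
  third letter `e ∉ {a, b′}` carrying `ℓ_k`, `2 ≤ d < p` and `p ≤ r_k(a) + r_k(b′) + 2` ⇒ FALSE: K9 reads `coeff_{x_e} h ≠ 0`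
  off each ledger, K8 (`IsolatedBand.exists_unit_mul_mem_span_X_hasseDeriv_pow_of_mem`) converts BOTH ledgers to the
  common Hasse contact polynomial `H = D_e^{(d−1)} G_k` (`H ∈ 𝔪₀`, `H ∉ (x_a, x_{b′})` by the glue file), and K1∘K2
  (`not_isIsolated_monomial_mul_of_two_ledgers`) contradicts `IsIsolated p (c k).F` via `F_k = x^{r_k} G_k`.
Part 2 (`…ResConeStretchLedger`, after res-dim4-p-3 g3's K4 `…ResConeLedgerPersist` lands) carries the seed through the
`E_a`-keeping steps (K11a `stretch_ledger`) and states the holder's `stretch_no_heavy_pair` over the KEPT predicates.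

[cite: CossartJannsenSaito2020, Thm. 3.10(4), Thm. 3.14]
bears_on: LADDER-RESOLUTION:D157-DOOR2 (res-dim4-pi · K2(p) slice B · (K11) part 1).
Supports stmt-ResolutionOfSingularities-16155 (helper).
-/

set_option linter.dupNamespace false -- mandated namespace of this single-conjunct summit

noncomputable section

namespace Summit.ResolutionOfSingularities.ResolutionOfSingularities.Theorems.PIDim4

namespace ResCone

open MvPolynomial Finset
open Literature.AlgebraicGeometry.Resolution
open Literature.AlgebraicGeometry.Resolution.CentreBlowup
open Literature.AlgebraicGeometry.Resolution.Hauser2010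
open Literature.AlgebraicGeometry.Resolution.HauserPerlega2019
open PointBlowup (polarMap additiveSubspace direction)

variable {K : Type} [Field K]

/-! ## §1 Frame helpers -/

/-- **The residual cone is the degree-`d` part of the residual polynomial**: for `ord₀ F = o` and `x^r ∣ F`,
`resForm s = homogeneousComponent (o − |r|) (F / x^r)`. [folklore] -/
theorem resForm_eq_homogeneousComponent_divMonomial {s : State K} {o : ℕ} (ho : ordZero s.F = o)
    (hr : ∀ d ∈ s.F.support, s.r ≤ d) :
    resForm s = homogeneousComponent (o - s.r.degree) (s.F.divMonomial s.r) := by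
  classical
  have hro : s.r.degree ≤ o := degree_r_le ho hr
  ext μ
  rw [coeff_resForm, Directrix.initialForm_eq_homogeneousComponent ho, coeff_homogeneousComponent,
    coeff_homogeneousComponent, coeff_divMonomial, map_add]
  by_cases hμ : μ.degree = o - s.r.degree
  · rw [if_pos hμ, if_pos (by omega)]
  · rw [if_neg hμ, if_neg (by omega)]

/-- **The residual polynomial has order exactly `d = o − |r|`.** [folklore] -/
theorem ordZero_divMonomial_eq {s : State K} {o : ℕ} (ho : ordZero s.F = o) (hr : ∀ d ∈ s.F.support, s.r ≤ d) :
    ordZero (s.F.divMonomial s.r) = ((o - s.r.degree : ℕ) : ℕ∞) := by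
  classical
  rw [ordZero_eq_nat_iff]
  obtain ⟨⟨d₀, hd₀, hd₀deg⟩, -⟩ := (ordZero_eq_nat_iff _ _).mp ho
  have hd₀s : d₀ ∈ s.F.support := MvPolynomial.mem_support_iff.mpr hd₀
  refine ⟨⟨d₀ - s.r, ?_, ?_⟩, fun μ hμ => ?_⟩
  · rw [coeff_divMonomial, add_tsub_cancel_of_le (hr d₀ hd₀s)]; exact hd₀
  · have h := PointBlowup.degree_le_degree_of_le (hr d₀ hd₀s)
    have h2 : (s.r + (d₀ - s.r)).degree = d₀.degree := by rw [add_tsub_cancel_of_le (hr d₀ hd₀s)]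
    rw [map_add] at h2
    omega
  · rw [coeff_divMonomial]
    by_contra hne
    have h := forall_le_degree_divMonomial ho μ (MvPolynomial.mem_support_iff.mpr (by rwa [coeff_divMonomial]))
    omega

/-- A polynomial in `(x_a)` has no `x_a`-free monomial. [folklore] -/
theorem coeff_eq_zero_of_mem_span_X {a : Fin 4} {P : MvPolynomial (Fin 4) K}
    (hP : P ∈ Ideal.span ({X a} : Set (MvPolynomial (Fin 4) K))) {μ : Fin 4 →₀ ℕ} (hμa : μ a = 0) :
    coeff μ P = 0 := by
  classical
  obtain ⟨Q, hQ⟩ := Ideal.mem_span_singleton'.mp hP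
  rw [← hQ, coeff_mul_X', if_neg (by rw [Finsupp.mem_support_iff]; exact fun h => h hμa)]

/-- **A power cone alive at a letter `c ≠ a` is not in `(x_a)`.** [folklore] -/
theorem homogeneousComponent_not_mem_span_X_of_powerCone {G : MvPolynomial (Fin 4) K} {d : ℕ} {a₀ : K}
    {ℓ : Fin 4 → K} (hcone : homogeneousComponent d G = C a₀ * (∑ i, C (ℓ i) * X i) ^ d) (ha₀ : a₀ ≠ 0)
    {a c : Fin 4} (hca : c ≠ a) (hc : ℓ c ≠ 0) :
    homogeneousComponent d G ∉ Ideal.span ({X a} : Set (MvPolynomial (Fin 4) K)) := by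
  intro hmem
  obtain ⟨μ, hμa, -, hμ⟩ := exists_coeff_ne_zero_of_eq_C_mul_pow hcone ha₀ hca hc
  exact hμ (coeff_eq_zero_of_mem_span_X hmem hμa)

/-- **The ledger polynomial lives on every letter carrying the cone** (K9 read at `e ≠ a`): if `u·G ∈ (x_a, h^d)`
(`u(0) ≠ 0`, `h ∈ 𝔪₀`, `ord₀ G = d ≥ 1`) and the cone of `G` is `a₀·ℓ^d` alive off `a`, then `coeff_{x_e} h ≠ 0` at every
`e ≠ a` with `ℓ_e ≠ 0`. [OURS] -/
theorem coeff_single_ne_zero_of_ledger {a e : Fin 4} (hea : e ≠ a) {u G h : MvPolynomial (Fin 4) K} {d : ℕ}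
    (hd : 1 ≤ d) (hG : u * G ∈ Ideal.span {(X a : MvPolynomial (Fin 4) K), h ^ d})
    (hu : MvPolynomial.eval (0 : Fin 4 → K) u ≠ 0) (hh : h ∈ originIdeal K) (hordG : ordZero G = (d : ℕ∞))
    {a₀ : K} (ha₀ : a₀ ≠ 0) {ℓ : Fin 4 → K} (hcone : homogeneousComponent d G = C a₀ * (∑ i, C (ℓ i) * X i) ^ d)
    (he : ℓ e ≠ 0) : coeff (Finsupp.single e 1) h ≠ 0 := by
  classical
  have hg := homogeneousComponent_not_mem_span_X_of_powerCone hcone ha₀ hea he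
  obtain ⟨κ, κ', hκ, hlin⟩ := exists_homogeneousComponent_one_eq_of_ledger hd hG hu hh hordG hg hcone
  have h1 : coeff (Finsupp.single e 1) h = coeff (Finsupp.single e 1) (homogeneousComponent 1 h) := by
    rw [coeff_homogeneousComponent, Finsupp.degree_single, if_pos rfl]
  rw [h1, hlin, coeff_add, coeff_C_mul, coeff_single_linearForm, coeff_C_mul, coeff_X,
    if_neg (fun h => hea (Finsupp.single_left_injective one_ne_zero h).symm), mul_zero, add_zero]
  exact mul_ne_zero hκ he

/-- The direction clause in K3's spelling: for `b j = 0`, `ℓ ⬝ᵥ b = Σ_i ℓ_i b_i [i ≠ j]`. [folklore] -/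
theorem dotProduct_eq_sum_ite_of_apply_eq_zero (ℓ : Fin 4 → K) {b : Fin 4 → K} {j : Fin 4} (hbj : b j = 0) :
    dotProduct ℓ b = ∑ i, ℓ i * b i * (if i = j then 0 else 1) := by
  unfold dotProduct
  refine Finset.sum_congr rfl fun i _ => ?_
  by_cases hij : i = j
  · rw [if_pos hij, hij, hbj, mul_zero, zero_mul]
  · rw [if_neg hij, mul_one]

section Chain

variable (p : ℕ) [hp : Fact p.Prime] [CharP K p] [DecidableEq K]

/-! ## §2 The seed at every birth -/

omit [CharP K p] in
/-- **THE LEDGER SEED at every birth** (K3 with the chain's band data): for `k ≥ k₀` on a constant-shade tail and frame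
data `resForm (c k) = C a₀ * (Σ C ℓᵢ Xᵢ)^d`, `ℓ (j k) + ℓ ⬝ᵥ b k = 0`: the letter `j_k` is born with multiplicity
`r_{k+1}(j_k) = o_k − p ≥ 1`, and `G_{k+1} ∈ (x_{j_k}, L̃^d)` with `L̃ = Σ_{i ≠ j k} ℓᵢ xᵢ ∈ 𝔪₀`. [OURS]
[cite: CossartJannsenSaito2020, Thm. 3.14] -/
theorem stretch_seed_ledger {c : ℕ → State K} {j : ℕ → Fin 4} {b : ℕ → Fin 4 → K}
    (hc : ∀ k, IsIsolated p (c k).F ∧ Step0 p (c k) (c (k + 1))) (hw : FreeTail.IsWitnessedChain p c j b)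
    (hr0 : ∀ e ∈ (c 0).F.support, (c 0).r ≤ e) (hfloor : ∀ k, ordZero (c k).F ≠ p) {k₀ d : ℕ}
    (hshade : ∀ k, k₀ ≤ k → (c k).shade = (d : ℕ∞)) {k : ℕ} (hk : k₀ ≤ k) {ℓ : Fin 4 → K} {a₀ : K}
    (hform : resForm (c k) = C a₀ * (∑ i, C (ℓ i) * X i) ^ d) (hdir : ℓ (j k) + dotProduct ℓ (b k) = 0) :
    1 ≤ (c (k + 1)).r (j k) ∧
      (∑ i, C (Function.update ℓ (j k) 0 i) * X i : MvPolynomial (Fin 4) K) ∈ originIdeal K ∧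
      (1 : MvPolynomial (Fin 4) K) * ((c (k + 1)).F.divMonomial (c (k + 1)).r) ∈
        Ideal.span {(X (j k) : MvPolynomial (Fin 4) K), (∑ i, C (Function.update ℓ (j k) 0 i) * X i) ^ d} := by
  classical
  obtain ⟨o, ho, hpo, ho2, -⟩ := chain_shade_nat p hc hfloor hshade hk
  have hr := IsolatedBand.isolated_chain_forall_le hc hr0 k
  have hck := (hw k).2.2.2.2
  refine ⟨?_, ?_, ?_⟩
  · rw [hck, step_r_univ p (j k) (hw k).2.1 (c k) ho hr, Finsupp.update_apply, if_pos rfl]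
    omega
  · unfold originIdeal
    rw [RingHom.mem_ker, map_sum]
    exact Finset.sum_eq_zero fun i _ => by rw [map_mul, eval_X, Pi.zero_apply, mul_zero]
  · have hdir' : ℓ (j k) + ∑ i, ℓ i * b k i * (if i = j k then 0 else 1) = 0 := by
      rw [← dotProduct_eq_sum_ite_of_apply_eq_zero ℓ (hw k).2.1]; exact hdir
    rw [one_mul, hck]
    exact divMonomial_step_mem_span_of_powerCone (j k) (hw k).2.1 ho hr hpo ho2 hform hdir'

/-! ## §3 The kill from two one-letter ledgers -/

/-- **NO HEAVY PAIR from two ledgers** (K11b core; I-4-7 (DL) for every `p` and `2 ≤ d < p`): at a stage `k ≥ k₀` of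
a constant-shade tail of an isolated above-floor `Step0 p` chain with `x^{r₀} ∣ F₀`, given the frame
`resForm (c k) = C a₀ * (Σ C ℓᵢ Xᵢ)^d`, two distinct letters `a, b′` with one-letter ledgers `u_a·G_k ∈ (x_a, h_a^d)`,
`u_b·G_k ∈ (x_{b′}, h_b^d)` (`u_a(0), u_b(0) ≠ 0`, `h_a, h_b ∈ 𝔪₀`), and a third letter `e ∉ {a, b′}` carrying `ℓ`,
the multiplicities CANNOT satisfy `p ≤ r_k(a) + r_k(b′) + 2`. [OURS] [cite: CossartJannsenSaito2020, Thm. 3.14] -/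
theorem stretch_false_of_two_ledgers {c : ℕ → State K} (hc : ∀ k, IsIsolated p (c k).F ∧ Step0 p (c k) (c (k + 1)))
    (hr0 : ∀ e ∈ (c 0).F.support, (c 0).r ≤ e) (hfloor : ∀ k, ordZero (c k).F ≠ p) {k₀ d : ℕ} (hd2 : 2 ≤ d)
    (hdp : d < p) (hshade : ∀ k, k₀ ≤ k → (c k).shade = (d : ℕ∞)) {k : ℕ} (hk : k₀ ≤ k) {ℓ : Fin 4 → K} {a₀ : K}
    (hform : resForm (c k) = C a₀ * (∑ i, C (ℓ i) * X i) ^ d) {a b' e : Fin 4} (hab : a ≠ b') (hea : e ≠ a)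
    (heb : e ≠ b') (he : ℓ e ≠ 0) {ua ha ub hb : MvPolynomial (Fin 4) K}
    (hua : MvPolynomial.eval (0 : Fin 4 → K) ua ≠ 0) (hha : ha ∈ originIdeal K)
    (hGa : ua * ((c k).F.divMonomial (c k).r) ∈ Ideal.span {(X a : MvPolynomial (Fin 4) K), ha ^ d})
    (hub : MvPolynomial.eval (0 : Fin 4 → K) ub ≠ 0) (hhb : hb ∈ originIdeal K)
    (hGb : ub * ((c k).F.divMonomial (c k).r) ∈ Ideal.span {(X b' : MvPolynomial (Fin 4) K), hb ^ d})
    (hheavy : p ≤ (c k).r a + (c k).r b' + 2) : False := by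
  classical
  obtain ⟨o, ho, -, -, hod⟩ := chain_shade_nat p hc hfloor hshade hk
  have hr := IsolatedBand.isolated_chain_forall_le hc hr0 k
  have hd1 : 1 ≤ d := by omega
  -- the cone is the degree-`d` part of `G_k`, which has order exactly `d`
  have hcone : homogeneousComponent d ((c k).F.divMonomial (c k).r) = C a₀ * (∑ i, C (ℓ i) * X i) ^ d := by
    have h := hform
    rw [resForm_eq_homogeneousComponent_divMonomial ho hr, hod] at h
    exact h
  have ha₀ : a₀ ≠ 0 := ne_zero_of_resForm_eq_C_mul ho hr hform
  have hordG : ordZero ((c k).F.divMonomial (c k).r) = (d : ℕ∞) := by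
    rw [ordZero_divMonomial_eq ho hr, hod]
  have hordG' : ∀ e' ∈ ((c k).F.divMonomial (c k).r).support, d ≤ e'.degree := by
    intro e' he'
    have h := forall_le_degree_divMonomial ho e' he'
    rwa [hod] at h
  -- `x_e` carries both ledger polynomials (K9)
  have hca : MvPolynomial.eval (0 : Fin 4 → K) (hasseDeriv (Finsupp.single e 1) ha) ≠ 0 := by
    rw [IsolatedBand.eval_hasseDeriv_single_one]
    exact coeff_single_ne_zero_of_ledger hea hd1 hGa hua hha hordG ha₀ hcone he
  have hcb : MvPolynomial.eval (0 : Fin 4 → K) (hasseDeriv (Finsupp.single e 1) hb) ≠ 0 := by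
    rw [IsolatedBand.eval_hasseDeriv_single_one]
    exact coeff_single_ne_zero_of_ledger heb hd1 hGb hub hhb hordG ha₀ hcone he
  -- `x_a`-free and `x_{b′}`-free degree-`d` monomials of `G_k` (K10)
  obtain ⟨μa, hμa, hμad, hμa0⟩ := exists_coeff_ne_zero_of_eq_C_mul_pow hcone ha₀ hea he
  obtain ⟨μb, hμb, hμbd, hμb0⟩ := exists_coeff_ne_zero_of_eq_C_mul_pow hcone ha₀ heb he
  have hcoeff : ∀ {μ : Fin 4 →₀ ℕ}, μ.degree = d →
      coeff μ (homogeneousComponent d ((c k).F.divMonomial (c k).r)) ≠ 0 →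
        coeff μ ((c k).F.divMonomial (c k).r) ≠ 0 := by
    intro μ hμd h
    rwa [coeff_homogeneousComponent, if_pos hμd] at h
  -- both ledgers converted to the common Hasse contact polynomial (K8)
  obtain ⟨va, hva, hGa'⟩ := IsolatedBand.exists_unit_mul_mem_span_X_hasseDeriv_pow_of_mem p hea hd1 hdp hha
    hGa hua hca hordG' hμa hμad (hcoeff hμad hμa0)
  obtain ⟨vb, hvb, hGb'⟩ := IsolatedBand.exists_unit_mul_mem_span_X_hasseDeriv_pow_of_mem p heb hd1 hdp hhb
    hGb hub hcb hordG' hμb hμbd (hcoeff hμbd hμb0)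
  have hH : hasseDeriv (Finsupp.single e (d - 1)) ((c k).F.divMonomial (c k).r) ∈ originIdeal K :=
    IsolatedBand.hasseDeriv_single_mem_originIdeal e hd2 hordG'
  have hH' := IsolatedBand.hasseDeriv_powerCone_not_mem_span_X_pair p hea heb hd1 hdp ha₀ he hcone
  -- the double-ledger kill (K1 ∘ K2) against isolation of `F_k = x^{r_k} · G_k`
  have hkill := IsolatedBand.not_isIsolated_monomial_mul_of_two_ledgers hab hH hH' hva hvb hGa' hGb' hd2
    (c k).r hheavy
  rw [monomial_mul_divMonomial hr] at hkill
  exact hkill (hc k).1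

end Chain

end ResCone

end Summit.ResolutionOfSingularities.ResolutionOfSingularities.Theorems.PIDim4

end
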